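import Summits.AtomisticToContinuum.Crystallization.Theses.ChessboardParticlePlanes
import Summits.AtomisticToContinuum.Crystallization.Theorems.ChessboardParticlePlanesLjPlaneChessboardRestack
import Summits.AtomisticToContinuum.Crystallization.Theorems.ChessboardParticlePlanesLjPlaneChessboardPlanarPeriods
import Summits.AtomisticToContinuum.Crystallization.Theorems.ChessboardParticlePlanesLjPlaneChessboardSumToMinLayers

/-!
# Crux `LjPlaneChessboard` (stmt-AtomisticToContinuum-6709), line `Sketch` — stub `stub_sumToMin`

From the per-site deficit inequality to the min-form of the chessboard estimate (the pigeonhole).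

Let `Q` be a periodic configuration of `ℝ³` whose periods have heights in `c₀ℤ` (`c₀ > 0` the
height of a period `w`), with next / previous occupied height maps `τu`, `τd`.  Write
`h_S(p) = ∑' y ∈ S ∖ {p}, V |p − y|` for the site sum of a point set `S` and `R(t,t')` for the
period-2 restack of the layers at heights `t < t'`.  Assume
(i) the layer-adapted energy formula
`2 (#F_t + #F_{t'}) e(B) = Σ_{F_t} h_R ∘ rep + Σ_{F_{t'}} h_R ∘ rep'` for every occupied pair
`t < t'` and every periodic `B` with `B.points = R(t,t')`, and
(ii) `0 ≤ Σ_{x ∈ F} [2 h_Q(x) − h_{R(x₂, τu x₂)}(x) − h_{R(τd x₂, x₂)}(x)]`.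
Then some ADJACENT pair `t < τu t` of occupied heights has a restack `B` with `e(B) ≤ e(Q)`.

PROOF (bookkeeping).  `θ = toIcoMod c₀ t₀` reduces heights to one vertical period
`[t₀, t₀ + c₀)`; `T = θ(heights of F)` is the finite set of occupied height classes, each
occupied; `F_t` (`t ∈ T`) are the fibres of `x ↦ θ (x 2)` on the motif `F`, so `Σ_T #F_t = #F`.
Site sums are translation-covariant and restacks shift with the vertical period
(`R(s + kc₀, s' + kc₀) = R(s,s') + k w`), and `τu (s + kc₀) = τu s + kc₀`, `τd` likewise,
`τd ∘ τu = id` on occupied heights; hence `σ t := θ (τu t)` permutes `T`, and translating each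
`x ∈ F` into its own layer class turns `Σ_F h_{R⁺}` into `Σ_{t∈T} Σ_{F_t} h_{R(t,τu t)} ∘ rep` and
(re-indexing along `σ`) `Σ_F h_{R⁻}` into `Σ_{t∈T} Σ_{F_{τu t}} h_{R(t,τu t)} ∘ rep'_t`.  With (i),
`Σ_F [h_{R⁺} + h_{R⁻}] = Σ_T 2(#F_t + #F_{τu t}) e(B_t)`, while `Σ_F 2 h_Q = 4 #F e(Q)` and
`Σ_T (#F_t + #F_{τu t}) = 2 #F`; so (ii) forces `e(B_t) ≤ e(Q)` for some `t ∈ T`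
(min ≤ weighted mean).  The restacks `B_t` exist by `stub_restack` + `stub_planarPeriods`; the
layer bookkeeping lemmas (covariance, class map, `τu`/`τd` rules) are in
`…LjPlaneChessboardSumToMinLayers.lean`.
No definition and no notation is introduced (restack sets and site sums are written out literally).
-/

noncomputable section

namespace Summit.AtomisticToContinuum.Crystallization.Theorems.ChessboardParticlePlanesLjPlaneChessboard

open Literature.MathematicalPhysics.StatisticalMechanics

/-- **Stub 10 — from the per-site deficit to the min-form (L; the pigeonhole).**  Let `Q` be
layer-confined (`c₀`, `τu`, `τd` as in stubs 1 and 8 of the lead's skeleton) and suppose (i) the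
layer-adapted energy formula of stub 9 for every occupied pair `t < t'` and (ii) the per-site
deficit inequality `0 ≤ Σ_{x ∈ F} [2 h_Q(x) − h_{R(x₂, τu x₂)}(x) − h_{R(τd x₂, x₂)}(x)]`.  Then
some ADJACENT pair of occupied heights `t < t'` has its restack `B` (which exists:
`stub_restack`) with `e(B) ≤ e(Q)`.  Proof: enumerate the occupied height classes of one vertical period,
`T = θ(heights of F)` (finite, `σ = θ ∘ τu` permutes it); translating each `x ∈ F` by the multiple
of the period `w` that puts it into its own layer class representative turns `Σ_F h_{R⁺}` and
`Σ_F h_{R⁻}` into `Σ_{t ∈ T} [Σ_{F_t} h_{R(t,τu t)} ∘ rep + Σ_{F_{τu t}} h_{R(t, τu t)} ∘ rep']`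
`= Σ_{t ∈ T} 2 (N_t + N_{τu t}) e(B_t)` (hypothesis (i); site sums are translation-covariant),
while `Σ_F 2 h_Q = 4 N e(Q)` and `Σ_{t ∈ T} (N_t + N_{τu t}) = 2N`; hence
`Σ_t (N_t + N_{τu t})(e(B_t) − e(Q)) ≤ 0` and some `t` with `N_t ≥ 1` has `e(B_t) ≤ e(Q)`.
The `2/3`-separation and the `3/4`-height-separation hypotheses are carried but not used.
[folklore; GiulianiLebowitzLieb2008 Lemma 1 (min ≤ weighted mean)] -/
theorem stub_sumToMin :
    ∀ (Q : PeriodicConfiguration 3) (c₀ : ℝ) (τu τd : ℝ → ℝ),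
      (∀ x ∈ Q.points, ∀ y ∈ Q.points, x ≠ y → (2 : ℝ) / 3 ≤ dist x y) →
      (∀ x ∈ Q.points, ∀ y ∈ Q.points, x 2 ≠ y 2 → (3 : ℝ) / 4 ≤ |x 2 - y 2|) →
      0 < c₀ → (∃ g ∈ Q.lattice, g 2 = c₀) → (∀ g ∈ Q.lattice, ∃ k : ℤ, g 2 = c₀ * k) →
      (∀ t : ℝ, (∃ x ∈ Q.points, x 2 = t) →
        (t < τu t ∧ (∃ x ∈ Q.points, x 2 = τu t) ∧ (∀ x ∈ Q.points, x 2 ≤ t ∨ τu t ≤ x 2)) ∧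
        (τd t < t ∧ (∃ x ∈ Q.points, x 2 = τd t) ∧ (∀ x ∈ Q.points, x 2 ≤ τd t ∨ t ≤ x 2))) →
      (∀ (t t' : ℝ) (B : PeriodicConfiguration 3) (Ft Ft' : Finset (EuclideanSpace ℝ (Fin 3)))
          (rep rep' : EuclideanSpace ℝ (Fin 3) → EuclideanSpace ℝ (Fin 3)) (V : ℝ → ℝ),
        t < t' → (∃ x ∈ Q.points, x 2 = t) → (∃ x ∈ Q.points, x 2 = t') →
        (∀ x, x ∈ Ft ↔ x ∈ Q.motif ∧ ∃ k : ℤ, x 2 = t + c₀ * k) →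
        (∀ x, x ∈ Ft' ↔ x ∈ Q.motif ∧ ∃ k : ℤ, x 2 = t' + c₀ * k) →
        (∀ x ∈ Ft, rep x ∈ Q.points ∧ rep x 2 = t ∧ x - rep x ∈ Q.lattice) →
        (∀ x ∈ Ft', rep' x ∈ Q.points ∧ rep' x 2 = t' ∧ x - rep' x ∈ Q.lattice) →
        B.points = {p : EuclideanSpace ℝ (Fin 3) | ∃ k : ℤ, ∃ x ∈ Q.points, (x 2 = t ∨ x 2 = t') ∧
          p = x + ((2 * (t' - t)) * (k : ℝ)) • EuclideanSpace.single (2 : Fin 3) (1 : ℝ)} →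
        2 * ((Ft.card : ℝ) + (Ft'.card : ℝ)) * B.energyPerParticle V =
          (∑ x ∈ Ft, ∑' y : {y : EuclideanSpace ℝ (Fin 3) // y ∈ B.points ∧ y ≠ rep x},
              V (dist (rep x) y.1)) +
          (∑ x ∈ Ft', ∑' y : {y : EuclideanSpace ℝ (Fin 3) // y ∈ B.points ∧ y ≠ rep' x},
              V (dist (rep' x) y.1))) →
      (0 ≤ ∑ x ∈ Q.motif,
        (2 * (∑' y : {y : EuclideanSpace ℝ (Fin 3) // y ∈ Q.points ∧ y ≠ x},
                lennardJones (dist x y.1))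
          - (∑' y : {y : EuclideanSpace ℝ (Fin 3) //
                y ∈ {p : EuclideanSpace ℝ (Fin 3) | ∃ k : ℤ, ∃ x' ∈ Q.points,
                  (x' 2 = x 2 ∨ x' 2 = τu (x 2)) ∧
                  p = x' + ((2 * (τu (x 2) - x 2)) * (k : ℝ)) •
                    EuclideanSpace.single (2 : Fin 3) (1 : ℝ)} ∧ y ≠ x},
                lennardJones (dist x y.1))
          - (∑' y : {y : EuclideanSpace ℝ (Fin 3) //
                y ∈ {p : EuclideanSpace ℝ (Fin 3) | ∃ k : ℤ, ∃ x' ∈ Q.points,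
                  (x' 2 = τd (x 2) ∨ x' 2 = x 2) ∧
                  p = x' + ((2 * (x 2 - τd (x 2))) * (k : ℝ)) •
                    EuclideanSpace.single (2 : Fin 3) (1 : ℝ)} ∧ y ≠ x},
                lennardJones (dist x y.1)))) →
      ∃ t t' : ℝ, t < t' ∧ (∃ x ∈ Q.points, x 2 = t) ∧ (∃ x ∈ Q.points, x 2 = t') ∧
        (∀ x ∈ Q.points, x 2 ≤ t ∨ t' ≤ x 2) ∧
        ∃ B : PeriodicConfiguration 3,
          B.points = {p : EuclideanSpace ℝ (Fin 3) | ∃ k : ℤ, ∃ x ∈ Q.points, (x 2 = t ∨ x 2 = t') ∧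
            p = x + ((2 * (t' - t)) * (k : ℝ)) • EuclideanSpace.single (2 : Fin 3) (1 : ℝ)} ∧
          B.energyPerParticle lennardJones ≤ Q.energyPerParticle lennardJones := by
  intro Q c₀ τu τd _ _ hc₀ hw hG Hτ HE HD
  classical
  obtain ⟨w, hwG, hw2⟩ := hw
  -- two independent horizontal periods (so every restack is a periodic configuration)
  have hab := stub_planarPeriods Q ⟨c₀, hc₀, ⟨w, hwG, hw2⟩, hG⟩
  have hkw : ∀ k : ℤ, (k : ℝ) • w ∈ Q.lattice := sumToMin_zsmul_mem hwG
  have hOF : ∀ y ∈ Q.motif, ∃ x ∈ Q.points, x 2 = y 2 := fun y hy =>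
    ⟨y, Q.mem_points_of_mem_motif hy, rfl⟩
  obtain ⟨y₀, hy₀⟩ := Q.motif_nonempty
  -- STEP 1: one vertical period — the class map `θ`, the winding number `κ`
  obtain ⟨θ, κ, hθ1, hθ2, hθ3⟩ := sumToMin_classMap hc₀ (y₀ 2)
  -- the occupied height classes `T`
  generalize hT : Q.motif.image (fun y => θ (y 2)) = T
  have hmaps : ∀ x ∈ Q.motif, θ (x 2) ∈ T := fun x hx => by
    rw [← hT]
    exact Finset.mem_image_of_mem (fun y => θ (y 2)) hx
  have hTmem : ∀ t ∈ T, ∃ y ∈ Q.motif, θ (y 2) = t := fun t ht => by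
    rw [← hT] at ht
    exact Finset.mem_image.1 ht
  have hT1 : ∀ t ∈ T, ∃ x ∈ Q.points, x 2 = t := by
    intro t ht
    obtain ⟨y, hy, rfl⟩ := hTmem t ht
    have e : θ (y 2) = y 2 + c₀ * ((-κ (y 2) : ℤ) : ℝ) := by
      push_cast
      linear_combination hθ1 (y 2)
    rw [e]
    exact sumToMin_occ_shift hwG hw2 (hOF y hy) _
  have hT2 : ∀ s, (∃ x ∈ Q.points, x 2 = s) → θ s ∈ T := by
    rintro s ⟨x, hx, rfl⟩
    obtain ⟨z, hz, hxz⟩ := Q.exists_sub_mem_lattice hx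
    obtain ⟨k, hk⟩ := hG _ hxz
    have hsub : (x - z) 2 = x 2 - z 2 := by simp
    have e : θ (x 2) = θ (z 2) := (hθ2 (x 2) (z 2)).1 ⟨k, by linear_combination hk - hsub⟩
    rw [e]
    exact hmaps z hz
  have hT3 : ∀ t ∈ T, θ t = t := by
    intro t ht
    obtain ⟨y, -, rfl⟩ := hTmem t ht
    exact hθ3 _
  have hTne : T.Nonempty := ⟨_, hmaps y₀ hy₀⟩
  have hOθ : ∀ x ∈ Q.motif, ∃ x' ∈ Q.points, x' 2 = θ (x 2) := fun x hx => hT1 _ (hmaps x hx)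
  -- the layer classes `F_t` of the motif
  obtain ⟨Ft, hF1⟩ : ∃ Ft : ℝ → Finset (EuclideanSpace ℝ (Fin 3)),
      ∀ t x, x ∈ Ft t ↔ x ∈ Q.motif ∧ ∃ k : ℤ, x 2 = t + c₀ * k :=
    ⟨fun t => Q.motif.filter (fun x => ∃ k : ℤ, x 2 = t + c₀ * k), fun t x => Finset.mem_filter⟩
  have hF2 : ∀ t x, x ∈ Ft t ↔ x ∈ Q.motif ∧ θ (x 2) = θ t := fun t x => by rw [hF1, hθ2]
  have hF3 : ∀ t ∈ T, Q.motif.filter (fun x => θ (x 2) = t) = Ft t := fun t ht => by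
    ext x
    rw [Finset.mem_filter, hF2, hT3 t ht]
  have hF5 : ∀ t ∈ T, 0 < (Ft t).card := fun t ht => by
    obtain ⟨y, hy, rfl⟩ := hTmem t ht
    exact Finset.card_pos.2 ⟨y, (hF2 _ y).2 ⟨hy, (hθ3 _).symm⟩⟩
  -- the permutation `σ = θ ∘ τu` of the classes
  obtain ⟨σ, hσ⟩ : ∃ σ : ℝ → ℝ, ∀ t, σ t = θ (τu t) := ⟨fun t => θ (τu t), fun _ => rfl⟩
  have hσ1 : ∀ t ∈ T, σ t ∈ T := fun t ht => by
    rw [hσ]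
    exact hT2 _ (Hτ t (hT1 t ht)).1.2.1
  have hσinj : Set.InjOn σ ↑T := by
    intro t ht t' ht' h
    rw [hσ, hσ] at h
    obtain ⟨k, hk⟩ := (hθ2 _ _).2 h
    have hOt := hT1 t ht
    have hOt' := hT1 t' ht'
    rw [← sumToMin_tau_up_shift Hτ hwG hw2 hOt' k] at hk
    have htt' := sumToMin_tau_up_inj Hτ hOt (sumToMin_occ_shift hwG hw2 hOt' k) hk
    have hθtt' := (hθ2 t t').1 ⟨k, htt'⟩
    rwa [hT3 t ht, hT3 t' ht'] at hθtt'
  have hσimg : T.image σ = T :=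
    Finset.eq_of_subset_of_card_le (Finset.image_subset_iff.2 hσ1)
      (by rw [Finset.card_image_of_injOn hσinj])
  have hσ5 : ∀ t, Ft (σ t) = Ft (τu t) := fun t => by
    ext x
    rw [hF2, hF2, hσ, hθ3]
  -- STEP 2: layer representatives `rep x = x − κ(x₂) w`, `rep'_t x = rep x + κ(τu t) w`
  obtain ⟨rep, hr1, hr2, hr3, hr4⟩ :
      ∃ rep : EuclideanSpace ℝ (Fin 3) → EuclideanSpace ℝ (Fin 3),
        (∀ x ∈ Q.motif, rep x ∈ Q.points) ∧ (∀ x, rep x 2 = θ (x 2)) ∧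
        (∀ x, x - rep x ∈ Q.lattice) ∧ (∀ x, rep x + (κ (x 2) : ℝ) • w = x) := by
    refine ⟨fun x => x - (κ (x 2) : ℝ) • w, fun x hx => ?_, fun x => ?_, fun x => ?_,
      fun x => sub_add_cancel x _⟩
    · show x - (κ (x 2) : ℝ) • w ∈ Q.points
      rw [sub_eq_add_neg]
      exact Q.add_mem_points (Q.mem_points_of_mem_motif hx) (Q.lattice.neg_mem (hkw _))
    · show (x - (κ (x 2) : ℝ) • w) 2 = θ (x 2)
      have e : (x - (κ (x 2) : ℝ) • w) 2 = x 2 - κ (x 2) * c₀ := by simp [hw2]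
      rw [e]
      linear_combination -(hθ1 (x 2))
    · show x - (x - (κ (x 2) : ℝ) • w) ∈ Q.lattice
      rw [sub_sub_cancel]
      exact hkw _
  obtain ⟨rep', hr'⟩ : ∃ rep' : ℝ → EuclideanSpace ℝ (Fin 3) → EuclideanSpace ℝ (Fin 3),
      ∀ t x, rep' t x = rep x + (κ (τu t) : ℝ) • w :=
    ⟨fun t x => rep x + (κ (τu t) : ℝ) • w, fun _ _ => rfl⟩
  have hrep : ∀ t ∈ T, ∀ x ∈ Ft t, rep x ∈ Q.points ∧ rep x 2 = t ∧ x - rep x ∈ Q.lattice := by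
    intro t ht x hx
    obtain ⟨hxF, hxθ⟩ := (hF2 t x).1 hx
    exact ⟨hr1 x hxF, by rw [hr2, hxθ, hT3 t ht], hr3 x⟩
  have hrep' : ∀ t, ∀ x ∈ Ft (τu t),
      rep' t x ∈ Q.points ∧ rep' t x 2 = τu t ∧ x - rep' t x ∈ Q.lattice := by
    intro t x hx
    obtain ⟨hxF, hxθ⟩ := (hF2 _ x).1 hx
    rw [hr']
    refine ⟨Q.add_mem_points (hr1 x hxF) (hkw _), ?_, ?_⟩
    · have e : (rep x + (κ (τu t) : ℝ) • w) 2 = rep x 2 + κ (τu t) * c₀ := by simp [hw2]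
      rw [e, hr2, hxθ]
      linear_combination hθ1 (τu t)
    · rw [sub_add_eq_sub_sub]
      exact Q.lattice.sub_mem (hr3 x) (hkw _)
  -- the restacks `B_t` of the adjacent pairs `(t, τu t)`
  have hBex : ∀ t, ∃ B : PeriodicConfiguration 3, (∃ x ∈ Q.points, x 2 = t) →
      B.points = {p : EuclideanSpace ℝ (Fin 3) | ∃ k : ℤ, ∃ x ∈ Q.points,
        (x 2 = t ∨ x 2 = τu t) ∧
        p = x + ((2 * (τu t - t)) * (k : ℝ)) • EuclideanSpace.single (2 : Fin 3) (1 : ℝ)} := by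
    intro t
    by_cases ht : ∃ x ∈ Q.points, x 2 = t
    · obtain ⟨B, hB⟩ := stub_restack Q hab t (τu t) (Hτ t ht).1.1 ht (Hτ t ht).1.2.1
      exact ⟨B, fun _ => hB⟩
    · exact ⟨Q, fun h => absurd h ht⟩
  choose B hB using hBex
  -- the site sums, abstracted
  obtain ⟨hQ, hhQ⟩ : ∃ f : EuclideanSpace ℝ (Fin 3) → ℝ, ∀ x, f x =
      ∑' y : {y : EuclideanSpace ℝ (Fin 3) // y ∈ Q.points ∧ y ≠ x},
        lennardJones (dist x y.1) :=
    ⟨_, fun _ => rfl⟩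
  obtain ⟨hU, hhU⟩ : ∃ f : EuclideanSpace ℝ (Fin 3) → ℝ, ∀ x, f x =
      ∑' y : {y : EuclideanSpace ℝ (Fin 3) //
        y ∈ {p : EuclideanSpace ℝ (Fin 3) | ∃ k : ℤ, ∃ x' ∈ Q.points,
          (x' 2 = x 2 ∨ x' 2 = τu (x 2)) ∧
          p = x' + ((2 * (τu (x 2) - x 2)) * (k : ℝ)) •
            EuclideanSpace.single (2 : Fin 3) (1 : ℝ)} ∧ y ≠ x},
        lennardJones (dist x y.1) :=
    ⟨_, fun _ => rfl⟩
  obtain ⟨hDn, hhDn⟩ : ∃ f : EuclideanSpace ℝ (Fin 3) → ℝ, ∀ x, f x =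
      ∑' y : {y : EuclideanSpace ℝ (Fin 3) //
        y ∈ {p : EuclideanSpace ℝ (Fin 3) | ∃ k : ℤ, ∃ x' ∈ Q.points,
          (x' 2 = τd (x 2) ∨ x' 2 = x 2) ∧
          p = x' + ((2 * (x 2 - τd (x 2))) * (k : ℝ)) •
            EuclideanSpace.single (2 : Fin 3) (1 : ℝ)} ∧ y ≠ x},
        lennardJones (dist x y.1) :=
    ⟨_, fun _ => rfl⟩
  obtain ⟨hR, hhR⟩ : ∃ f : ℝ → ℝ → EuclideanSpace ℝ (Fin 3) → ℝ, ∀ t t' p, f t t' p =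
      ∑' y : {y : EuclideanSpace ℝ (Fin 3) //
        y ∈ {q : EuclideanSpace ℝ (Fin 3) | ∃ k : ℤ, ∃ x ∈ Q.points, (x 2 = t ∨ x 2 = t') ∧
          q = x + ((2 * (t' - t)) * (k : ℝ)) • EuclideanSpace.single (2 : Fin 3) (1 : ℝ)} ∧
          y ≠ p}, lennardJones (dist p y.1) :=
    ⟨_, fun _ _ _ => rfl⟩
  have HD' : 0 ≤ ∑ x ∈ Q.motif, (2 * hQ x - hU x - hDn x) := by
    simpa only [hhQ, hhU, hhDn] using HD
  -- per-site covariance: translate `x` into its own layer class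
  have hUx : ∀ x ∈ Q.motif, hU x = hR (θ (x 2)) (τu (θ (x 2))) (rep x) := by
    intro x hx
    rw [hhU, hhR]
    have h := sumToMin_siteSum_up_shift Hτ hwG hw2 lennardJones (hOθ x hx) (κ (x 2)) (rep x)
    rw [hθ1 (x 2), hr4 x] at h
    exact h
  have hDx : ∀ x ∈ Q.motif, hDn x = hR (τd (θ (x 2))) (θ (x 2)) (rep x) := by
    intro x hx
    rw [hhDn, hhR]
    have h := sumToMin_siteSum_dn_shift Hτ hwG hw2 lennardJones (hOθ x hx) (κ (x 2)) (rep x)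
    rw [hθ1 (x 2), hr4 x] at h
    exact h
  -- STEP 3: regroup the upper restack sums by layer class
  have hSumU : ∑ x ∈ Q.motif, hU x = ∑ t ∈ T, ∑ x ∈ Ft t, hR t (τu t) (rep x) := by
    calc ∑ x ∈ Q.motif, hU x
        = ∑ x ∈ Q.motif, hR (θ (x 2)) (τu (θ (x 2))) (rep x) := Finset.sum_congr rfl hUx
      _ = ∑ t ∈ T, ∑ x ∈ Q.motif with θ (x 2) = t, hR (θ (x 2)) (τu (θ (x 2))) (rep x) :=
          (Finset.sum_fiberwise_of_maps_to hmaps _).symm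
      _ = ∑ t ∈ T, ∑ x ∈ Ft t, hR t (τu t) (rep x) := by
          refine Finset.sum_congr rfl fun t ht => ?_
          rw [hF3 t ht]
          refine Finset.sum_congr rfl fun x hx => ?_
          rw [((hF2 t x).1 hx).2, hT3 t ht]
  -- regroup the lower restack sums by the LOWER layer class, re-indexed along `σ`
  have hSumD : ∑ x ∈ Q.motif, hDn x = ∑ t ∈ T, ∑ x ∈ Ft (τu t), hR t (τu t) (rep' t x) := by
    calc ∑ x ∈ Q.motif, hDn x
        = ∑ x ∈ Q.motif, hR (τd (θ (x 2))) (θ (x 2)) (rep x) := Finset.sum_congr rfl hDx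
      _ = ∑ s ∈ T, ∑ x ∈ Q.motif with θ (x 2) = s, hR (τd (θ (x 2))) (θ (x 2)) (rep x) :=
          (Finset.sum_fiberwise_of_maps_to hmaps _).symm
      _ = ∑ s ∈ T, ∑ x ∈ Ft s, hR (τd s) s (rep x) := by
          refine Finset.sum_congr rfl fun s hs => ?_
          rw [hF3 s hs]
          refine Finset.sum_congr rfl fun x hx => ?_
          rw [((hF2 s x).1 hx).2, hT3 s hs]
      _ = ∑ s ∈ T.image σ, ∑ x ∈ Ft s, hR (τd s) s (rep x) := by rw [hσimg]
      _ = ∑ t ∈ T, ∑ x ∈ Ft (σ t), hR (τd (σ t)) (σ t) (rep x) :=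
          Finset.sum_image (f := fun s => ∑ x ∈ Ft s, hR (τd s) s (rep x)) hσinj
      _ = ∑ t ∈ T, ∑ x ∈ Ft (τu t), hR t (τu t) (rep' t x) := by
          refine Finset.sum_congr rfl fun t ht => ?_
          rw [hσ5 t]
          refine Finset.sum_congr rfl fun x _ => ?_
          have hOt := hT1 t ht
          have hOu := (Hτ t hOt).1.2.1
          have e1 : σ t + c₀ * (κ (τu t) : ℝ) = τu t := by
            rw [hσ]
            exact hθ1 _
          have e2 : τd (σ t) + c₀ * (κ (τu t) : ℝ) = t := by
            have hσt : σ t = τu t + c₀ * ((-κ (τu t) : ℤ) : ℝ) := by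
              push_cast
              linear_combination e1
            rw [hσt, sumToMin_tau_dn_shift Hτ hwG hw2 hOu, sumToMin_tau_dn_up Hτ hOt]
            push_cast
            ring
          rw [hhR, hhR, hr']
          have h := sumToMin_restack_siteSum_shift hwG hw2 lennardJones (τd (σ t)) (σ t)
            (κ (τu t)) (rep x)
          rw [e2, e1] at h
          exact h.symm
  -- STEP 4: the energy formula (i) on each adjacent pair `(t, τu t)`
  have hEt : ∀ t ∈ T, 2 * (((Ft t).card : ℝ) + ((Ft (τu t)).card : ℝ)) *
      (B t).energyPerParticle lennardJones =
      (∑ x ∈ Ft t, hR t (τu t) (rep x)) + (∑ x ∈ Ft (τu t), hR t (τu t) (rep' t x)) := by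
    intro t ht
    have hOt := hT1 t ht
    have h := HE t (τu t) (B t) (Ft t) (Ft (τu t)) rep (rep' t) lennardJones (Hτ t hOt).1.1
      hOt (Hτ t hOt).1.2.1 (hF1 t) (hF1 (τu t)) (hrep t ht) (hrep' t) (hB t hOt)
    rw [hB t hOt] at h
    simpa only [hhR] using h
  -- cardinalities: `Σ_T #F_t = #F = Σ_T #F_{τu t}`
  have hC1 : ∑ t ∈ T, ((Ft t).card : ℝ) = Q.motif.card := by
    rw [Finset.card_eq_sum_card_image (fun y => θ (y 2)) Q.motif, hT]
    push_cast
    exact Finset.sum_congr rfl fun t ht => by rw [hF3 t ht]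
  have hC2 : ∑ t ∈ T, ((Ft (τu t)).card : ℝ) = Q.motif.card := by
    rw [← hC1]
    calc ∑ t ∈ T, ((Ft (τu t)).card : ℝ)
        = ∑ t ∈ T, ((Ft (σ t)).card : ℝ) := by simp only [hσ5]
      _ = ∑ s ∈ T.image σ, ((Ft s).card : ℝ) :=
          (Finset.sum_image (f := fun s => ((Ft s).card : ℝ)) hσinj).symm
      _ = ∑ t ∈ T, ((Ft t).card : ℝ) := by rw [hσimg]
  -- the energy of `Q`: `Σ_F h_Q = 2 #F e(Q)`
  have hN : (0 : ℝ) < Q.motif.card := by exact_mod_cast Finset.card_pos.2 ⟨y₀, hy₀⟩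
  have hQsum : ∑ x ∈ Q.motif, hQ x =
      2 * (Q.motif.card : ℝ) * Q.energyPerParticle lennardJones := by
    have e : Q.energyPerParticle lennardJones =
        (2 * (Q.motif.card : ℝ))⁻¹ * ∑ x ∈ Q.motif, hQ x := by
      simp only [hhQ]
      rfl
    rw [e, ← mul_assoc, mul_inv_cancel₀ (mul_pos two_pos hN).ne', one_mul]
  -- STEP 5: pigeonhole (min ≤ weighted mean)
  have hle : ∑ t ∈ T, 2 * (((Ft t).card : ℝ) + ((Ft (τu t)).card : ℝ)) *
        (B t).energyPerParticle lennardJones ≤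
      ∑ t ∈ T, 2 * (((Ft t).card : ℝ) + ((Ft (τu t)).card : ℝ)) *
        Q.energyPerParticle lennardJones := by
    have h1 : ∑ t ∈ T, 2 * (((Ft t).card : ℝ) + ((Ft (τu t)).card : ℝ)) *
        (B t).energyPerParticle lennardJones =
        ∑ x ∈ Q.motif, hU x + ∑ x ∈ Q.motif, hDn x := by
      rw [hSumU, hSumD, ← Finset.sum_add_distrib]
      exact Finset.sum_congr rfl fun t ht => hEt t ht
    have h2 : ∑ t ∈ T, 2 * (((Ft t).card : ℝ) + ((Ft (τu t)).card : ℝ)) *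
        Q.energyPerParticle lennardJones = 2 * ∑ x ∈ Q.motif, hQ x := by
      rw [← Finset.sum_mul, ← Finset.mul_sum, Finset.sum_add_distrib, hC1, hC2, hQsum]
      ring
    have h3 : ∑ x ∈ Q.motif, (2 * hQ x - hU x - hDn x) =
        2 * ∑ x ∈ Q.motif, hQ x - ∑ x ∈ Q.motif, hU x - ∑ x ∈ Q.motif, hDn x := by
      rw [Finset.sum_sub_distrib, Finset.sum_sub_distrib, Finset.mul_sum]
    rw [h1, h2]
    linarith [HD', h3]
  obtain ⟨t, ht, hle_t⟩ := Finset.exists_le_of_sum_le hTne hle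
  have hOt := hT1 t ht
  have hpos : (0 : ℝ) < 2 * (((Ft t).card : ℝ) + ((Ft (τu t)).card : ℝ)) := by
    have h1 : (0 : ℝ) < (Ft t).card := by exact_mod_cast hF5 t ht
    have h2 : (0 : ℝ) ≤ (Ft (τu t)).card := Nat.cast_nonneg _
    linarith
  exact ⟨t, τu t, (Hτ t hOt).1.1, hOt, (Hτ t hOt).1.2.1, (Hτ t hOt).1.2.2, B t, hB t hOt,
    le_of_mul_le_mul_left hle_t hpos⟩

end Summit.AtomisticToContinuum.Crystallization.Theorems.ChessboardParticlePlanesLjPlaneChessboard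

end
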